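import Literature.AlgebraicGeometry.Motives.MumfordTateInvariantsTensorPairing
import Literature.AlgebraicGeometry.Motives.MumfordTateInvariantsBicommutant
import HarnessLib

/-!
# Mumford–Tate invariants and complete reducibility over any field `K ⊇ ℚ`, from the rational case

We prove `Deligne1982_mumfordTateInvariants_baseChange` (Deligne, *Hodge cycles on abelian
varieties*, LNM 900, I, Prop. 3.4 with its proof and Prop. 3.6, for the `K`-points `MT(H)(K)` of
the Mumford–Tate group acting on `T^{a,b}_K (K ⊗ V)`) FROM the rational statement
`Deligne1982_mumfordTateInvariants` (hypothesis `h`; both named facts live in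
`MumfordTateInvariants.lean`): `Deligne1982_mumfordTateInvariants_baseChange_of_rational`.

Part (i) (invariants) is `mem_span_of_forall_mumfordTateGroupBaseChange_of_rational`
(`MumfordTateInvariantsScalarExtension.lean`: invariants commute with extension of scalars).
Part (ii) (complete reducibility of `MT(H)(K)` on `T^{a,b}_K`) is reduced to ring theory as in
the proof of Deligne's Prop. 3.1(c) (`H = H'` for reductive `H`):

1. `dual_comp_tensorSpaceActOver_eq_of_rational` — the DUAL form of the definition of `MT(H)(K)`:
   an `MT(H)(ℚ)`-invariant linear form `λ` on a weight-`0` space `T^{c,d}` is the contraction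
   against an invariant tensor `y ∈ T^{d,c}` (perfectness of `tensorPairing`), which is a Hodge
   class by the rational statement (i), hence fixed by `MT(H)(K)` after base change; so `λ_K` is
   `MT(H)(K)`-invariant.
2. `comp_tensorSpaceActOver_eq_of_rational` — every `γ ∈ MT(H)(K)` commutes with `f_K` for every
   endomorphism `f` of `T^{a,b}` commuting with `MT(H)(ℚ)`: apply 1. to the invariant form
   `x ⊗ y ↦ ⟨y, f x⟩` on `T^{a,b} ⊗ T^{b,a} ≅ T^{a+b,b+a}` (`tensorSpaceMulEquiv`, always of weight
   `0`) and use non-degeneracy of the pairing over `K`.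
3. `exists_isCompl_of_forall_mumfordTateGroupBaseChange_of_rational` — transport to the honest
   base change `K ⊗_ℚ T^{a,b}`: by 2. and the bicommutant theorem
   (`MumfordTateInvariantsBicommutant.lean`) every `γ ∈ MT(H)(K)` acts through the `K`-span of
   the algebra `ℚ[MT(H)(ℚ)] ⊆ End(T^{a,b})`, which is semisimple by the rational statement (ii)
   and stays semisimple over `K` (characteristic `0`, Pierce §10.7); an `MT(H)(K)`-stable
   complement follows.

This replaces the Zariski-density argument of the printed proof (Borel, *Linear Algebraic
Groups*, 18.3: `MT(ℚ)` is dense in `MT`, so `MT_K`-invariants and `MT(K)`-invariants agree) by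
its consequence for the two statements at hand; no algebraic-group structure on `MT` is used.

## References

* P. Deligne, *Hodge cycles on abelian varieties* (notes by J. S. Milne), LNM 900 (1982), I,
  Prop. 3.1 (proof of (c)), Prop. 3.4, Prop. 3.6.
* A. Borel, *Linear Algebraic Groups*, 2nd ed. (1991), Thm. 18.2, Cor. 18.3.
* R. S. Pierce, *Associative Algebras* (1982), §10.7 Cor. b.

## Design

Theorems only; the rational named fact enters as the hypothesis `h` (no new named facts, D-0026).
All algebra requiring a ring structure is done on `K ⊗_ℚ T^{a,b}` and transported along the
comparison isomorphism `(isBaseChange_tensorSpaceToBaseChange K V a b).equiv`.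
-/

noncomputable section

open scoped TensorProduct

namespace Literature.AlgebraicGeometry.Motives

namespace HodgeStructure

universe u w

variable (K : Type w) [Field K] [Algebra ℚ K]
  {V : Type u} [AddCommGroup V] [Module ℚ V] [Module.Finite ℚ V] [HodgeTensorFacts.{u, u}] {n : ℤ}

/-- **Dual form of the definition of `MT(H)(K)`.** Under the rational statement `h`, for a
polarizable `H`, `(c - d) n = 0` and an `MT(H)(ℚ)`-invariant linear form `λ` on `T^{c,d} V`, the
`K`-linear extension `λ_K` of `λ` to `T^{c,d}_K (K ⊗ V)` is invariant under every
`γ ∈ MT(H)(K)`: `λ = ⟨y, ·⟩` for an `MT(H)(ℚ)`-invariant `y ∈ T^{d,c}` (perfect pairing), `y`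
is a Hodge class of type `(0,0)` by `h`, so `ι y` is fixed by `γ` and `λ_K = ⟨ι y, ·⟩` is
`γ`-invariant (Deligne, LNM 900, I, proof of Prop. 3.1(c) and Prop. 3.4).
[cite: Deligne1982HodgeCycles, I Prop. 3.4 (with proof)] -/
theorem dual_comp_tensorSpaceActOver_eq_of_rational (h : Deligne1982_mumfordTateInvariants.{u})
    (H : HodgeStructure V n) (hH : H.IsPolarizable) {c d : ℕ} (hcd : ((c : ℤ) - d) * n = 0)
    (lam : Module.Dual ℚ (hodgeTensorSpace V c d))
    (hlam : ∀ g ∈ H.mumfordTateGroup,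
      lam ∘ₗ (tensorSpaceAct (a := c) (b := d) g).toLinearMap = lam)
    {γ : (K ⊗[ℚ] V) ≃ₗ[K] (K ⊗[ℚ] V)} (hγ : γ ∈ H.mumfordTateGroupBaseChange K) :
    (isBaseChange_tensorSpaceToBaseChange K V c d).lift ((Algebra.linearMap ℚ K) ∘ₗ lam) ∘ₗ
        (tensorSpaceActOver (a := c) (b := d) γ).toLinearMap =
      (isBaseChange_tensorSpaceToBaseChange K V c d).lift ((Algebra.linearMap ℚ K) ∘ₗ lam) := by
  set lamK := (isBaseChange_tensorSpaceToBaseChange K V c d).lift ((Algebra.linearMap ℚ K) ∘ₗ lam)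
    with hlamKdef
  have hlamK : ∀ t, lamK (tensorSpaceToBaseChange K V c d t) = algebraMap ℚ K (lam t) := fun t =>
    (isBaseChange_tensorSpaceToBaseChange K V c d).lift_eq _ t
  -- the tensor `y ∈ T^{d,c}` representing `lam`
  obtain ⟨y, hy⟩ := exists_tensorPairing_eq (K := ℚ) (W := V) lam
  -- `y` is `MT(H)(ℚ)`-invariant
  have hyfix : ∀ g ∈ H.mumfordTateGroup, tensorSpaceAct g y = y := by
    intro g hg
    apply (tensorPairing_bijective (K := ℚ) (W := V) c d).1
    refine LinearMap.ext fun x => ?_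
    have hx : tensorSpaceAct (a := c) (b := d) g (tensorSpaceAct g⁻¹ x) = x := by
      rw [← tensorSpaceAct_mul_apply, mul_inv_cancel, tensorSpaceAct_one]; rfl
    have h1 : tensorPairing c d (tensorSpaceAct g y) x =
        tensorPairing c d y (tensorSpaceAct g⁻¹ x) := by
      conv_lhs => rw [← hx]
      exact tensorPairing_tensorSpaceActOver g y _
    have h2 := LinearMap.congr_fun (hlam g⁻¹ (H.mumfordTateGroup.inv_mem hg)) x
    simp only [LinearMap.comp_apply, LinearEquiv.coe_coe] at h2
    change tensorPairing c d (tensorSpaceAct g y) x = tensorPairing c d y x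
    rw [h1, hy, h2]
  -- hence a Hodge class of type `(0,0)`, whose base change is fixed by `MT(H)(K)`
  have hdc : ((d : ℤ) - c) * n = 0 := by linear_combination -hcd
  have hyH : y ∈ (H.tensorSpace d c).hodgeClasses 0 := (h H hH).1 d c hdc y hyfix
  have hfixK : ∀ γ' ∈ H.mumfordTateGroupBaseChange K,
      tensorSpaceActOver γ' (tensorSpaceToBaseChange K V d c y) = tensorSpaceToBaseChange K V d c y :=
    fun γ' hγ' => (H.mem_mumfordTateGroupBaseChange_iff K γ').1 hγ' d c hdc y hyH
  -- `lamK` is the contraction against `ι y`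
  have hlamK' : lamK = tensorPairing c d (tensorSpaceToBaseChange K V d c y) := by
    refine linearMap_ext_tensorSpaceToBaseChange K V fun x => ?_
    rw [hlamK, tensorPairing_tensorSpaceToBaseChange, hy]
  refine LinearMap.ext fun x => ?_
  rw [LinearMap.comp_apply, LinearEquiv.coe_coe, hlamK', tensorPairing_apply_tensorSpaceActOver,
    hfixK γ⁻¹ ((H.mumfordTateGroupBaseChange K).inv_mem hγ)]

/-- **`MT(H)(K)` commutes with the base change of every `MT(H)(ℚ)`-equivariant endomorphism of
`T^{a,b}`.** Under the rational statement `h`, for a polarizable `H`, an endomorphism `f` of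
`T^{a,b} V` commuting with `MT(H)(ℚ)`, a `K`-linear `f_K` on `T^{a,b}_K (K ⊗ V)` extending it
(`f_K ∘ ι = ι ∘ f`) and `γ ∈ MT(H)(K)`: `f_K ∘ γ = γ ∘ f_K`. Proof: the linear form
`x ⊗ y ↦ ⟨y, f x⟩` on `T^{a,b} ⊗ T^{b,a} ≅ T^{a+b,b+a}` (weight `0`) is `MT(H)(ℚ)`-invariant, so
by `dual_comp_tensorSpaceActOver_eq_of_rational` its extension `x' ⊗ y' ↦ ⟨y', f_K x'⟩` is
`γ`-invariant, i.e. `⟨γ y', f_K (γ x')⟩ = ⟨y', f_K x'⟩`; by invariance and non-degeneracy of the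
pairing this is `f_K ∘ γ = γ ∘ f_K` (Deligne, LNM 900, I, proof of Prop. 3.1(c)).
[cite: Deligne1982HodgeCycles, I Prop. 3.1(c) (proof) and Prop. 3.4] -/
theorem comp_tensorSpaceActOver_eq_of_rational (h : Deligne1982_mumfordTateInvariants.{u})
    (H : HodgeStructure V n) (hH : H.IsPolarizable) {a b : ℕ}
    (f : Module.End ℚ (hodgeTensorSpace V a b))
    (hf : ∀ g ∈ H.mumfordTateGroup,
      f * (tensorSpaceAct (a := a) (b := b) g).toLinearMap = (tensorSpaceAct g).toLinearMap * f)
    (fK : Module.End K (hodgeTensorSpaceOver K (K ⊗[ℚ] V) a b))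
    (hfK : ∀ t, fK (tensorSpaceToBaseChange K V a b t) = tensorSpaceToBaseChange K V a b (f t))
    {γ : (K ⊗[ℚ] V) ≃ₗ[K] (K ⊗[ℚ] V)} (hγ : γ ∈ H.mumfordTateGroupBaseChange K) :
    fK ∘ₗ (tensorSpaceActOver (a := a) (b := b) γ).toLinearMap =
      (tensorSpaceActOver (a := a) (b := b) γ).toLinearMap ∘ₗ fK := by
  -- the rational side
  let ρ : (V ≃ₗ[ℚ] V) → Module.End ℚ (hodgeTensorSpace V a b) :=
    fun g => (tensorSpaceAct g).toLinearMap
  let ρ' : (V ≃ₗ[ℚ] V) → Module.End ℚ (hodgeTensorSpace V b a) :=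
    fun g => (tensorSpaceAct g).toLinearMap
  let m := tensorSpaceMulEquiv (K := ℚ) (W := V) a b b a
  let Pflat : hodgeTensorSpace V a b ⊗[ℚ] hodgeTensorSpace V b a →ₗ[ℚ] ℚ :=
    TensorProduct.lift (tensorPairing (K := ℚ) (W := V) a b).flip
  let lam : Module.Dual ℚ (hodgeTensorSpace V (a + b) (b + a)) :=
    Pflat ∘ₗ TensorProduct.map f LinearMap.id ∘ₗ m.symm.toLinearMap
  have hPflat : ∀ g : V ≃ₗ[ℚ] V, Pflat ∘ₗ TensorProduct.map (ρ g) (ρ' g) = Pflat := by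
    intro g
    refine TensorProduct.ext' fun x y => ?_
    simp only [Pflat, ρ, ρ', LinearMap.comp_apply, TensorProduct.map_tmul, TensorProduct.lift.tmul,
      LinearMap.flip_apply, LinearEquiv.coe_coe]
    exact tensorPairing_tensorSpaceActOver g y x
  have hlam : ∀ g ∈ H.mumfordTateGroup,
      lam ∘ₗ (tensorSpaceAct (a := a + b) (b := b + a) g).toLinearMap = lam := by
    intro g hg
    refine LinearMap.ext fun z => ?_
    obtain ⟨w, rfl⟩ := m.surjective z
    have e1 : m.symm (tensorSpaceAct g (m w)) = TensorProduct.map (ρ g) (ρ' g) (m.symm (m w)) :=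
      tensorSpaceMulEquiv_symm_tensorSpaceActOver g (m w)
    have e2 : TensorProduct.map f LinearMap.id ∘ₗ TensorProduct.map (ρ g) (ρ' g) =
        TensorProduct.map (ρ g) (ρ' g) ∘ₗ TensorProduct.map f LinearMap.id := by
      rw [← TensorProduct.map_comp, ← TensorProduct.map_comp, LinearMap.id_comp, LinearMap.comp_id]
      have := hf g hg
      rw [Module.End.mul_eq_comp, Module.End.mul_eq_comp] at this
      rw [this]
    simp only [lam, LinearMap.comp_apply, LinearEquiv.coe_coe]
    rw [e1, LinearEquiv.symm_apply_apply, ← LinearMap.comp_apply (TensorProduct.map f LinearMap.id),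
      e2, LinearMap.comp_apply, ← LinearMap.comp_apply Pflat, hPflat g]
  have hcd : (((a + b : ℕ) : ℤ) - ((b + a : ℕ) : ℤ)) * n = 0 := by push_cast; ring
  have hL := dual_comp_tensorSpaceActOver_eq_of_rational K h H hH hcd lam hlam hγ
  -- the same form over `K`
  let mK := tensorSpaceMulEquiv (K := K) (W := K ⊗[ℚ] V) a b b a
  let PflatK : hodgeTensorSpaceOver K (K ⊗[ℚ] V) a b ⊗[K] hodgeTensorSpaceOver K (K ⊗[ℚ] V) b a →ₗ[K] K :=
    TensorProduct.lift (tensorPairing (K := K) (W := K ⊗[ℚ] V) a b).flip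
  let lamK' : Module.Dual K (hodgeTensorSpaceOver K (K ⊗[ℚ] V) (a + b) (b + a)) :=
    PflatK ∘ₗ TensorProduct.map fK LinearMap.id ∘ₗ mK.symm.toLinearMap
  have hlamK : (isBaseChange_tensorSpaceToBaseChange K V (a + b) (b + a)).lift
      ((Algebra.linearMap ℚ K) ∘ₗ lam) = lamK' := by
    refine linearMap_ext_tensorSpaceToBaseChange K V fun z => ?_
    rw [(isBaseChange_tensorSpaceToBaseChange K V _ _).lift_eq]
    obtain ⟨w, rfl⟩ := m.surjective z
    induction w using TensorProduct.induction_on with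
    | zero => simp
    | add w₁ w₂ h₁ h₂ =>
      simp only [map_add] at h₁ h₂ ⊢
      rw [h₁, h₂]
    | tmul x y =>
      simp only [lamK', lam, LinearMap.comp_apply, LinearEquiv.coe_coe, LinearEquiv.symm_apply_apply]
      rw [← tensorSpaceMulEquiv_tensorSpaceToBaseChange, LinearEquiv.symm_apply_apply]
      simp only [TensorProduct.map_tmul, LinearMap.id_coe, id_eq, Pflat, PflatK,
        TensorProduct.lift.tmul, LinearMap.flip_apply, hfK, Algebra.linearMap_apply,
        tensorPairing_tensorSpaceToBaseChange]
  rw [hlamK] at hL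
  -- evaluate the invariance of `lamK'` on `mK (x' ⊗ y')`
  have key : ∀ (x' : hodgeTensorSpaceOver K (K ⊗[ℚ] V) a b) (y' : hodgeTensorSpaceOver K (K ⊗[ℚ] V) b a),
      tensorPairing a b (tensorSpaceActOver γ y') (fK (tensorSpaceActOver γ x')) =
        tensorPairing a b y' (fK x') := by
    intro x' y'
    have := LinearMap.congr_fun hL (mK (x' ⊗ₜ[K] y'))
    simp only [lamK', LinearMap.comp_apply, LinearEquiv.coe_coe] at this
    rw [← tensorSpaceMulEquiv_map_tensorSpaceActOver, LinearEquiv.symm_apply_apply,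
      LinearEquiv.symm_apply_apply, TensorProduct.map_tmul, TensorProduct.map_tmul] at this
    simpa [PflatK, TensorProduct.lift.tmul] using this
  refine LinearMap.ext fun x' => eq_of_forall_tensorPairing_eq fun y'' => ?_
  simp only [LinearMap.comp_apply, LinearEquiv.coe_coe]
  have h1 := key x' (tensorSpaceActOver γ⁻¹ y'')
  rw [show tensorSpaceActOver (a := b) (b := a) γ (tensorSpaceActOver γ⁻¹ y'') = y'' by
    rw [← tensorSpaceActOver_mul_apply, mul_inv_cancel, tensorSpaceActOver_one]; rfl] at h1
  rw [h1]
  exact (tensorPairing_apply_tensorSpaceActOver γ y'' (fK x')).symm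

/-- **Part (ii) of `Deligne1982_mumfordTateInvariants_baseChange` from the rational statement**:
complete reducibility of `MT(H)(K)` on `T^{a,b}_K (K ⊗ V)` (Deligne, LNM 900, I Prop. 3.6 /
GGK (I.B.6), over any field `K ⊇ ℚ`). Transport along `K ⊗_ℚ T^{a,b} ≃ T^{a,b}_K`: by
`comp_tensorSpaceActOver_eq_of_rational` and the bicommutant theorem, each `γ ∈ MT(H)(K)` acts
through the `K`-span of the semisimple algebra `ℚ[MT(H)(ℚ)] ⊆ End(T^{a,b})` (semisimple by the
rational statement (ii)), which stays semisimple over `K`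
(`exists_isCompl_of_forall_baseChange_apply_mem'`). [cite: Deligne1982HodgeCycles, I Prop. 3.6] -/
theorem exists_isCompl_of_forall_mumfordTateGroupBaseChange_of_rational
    (h : Deligne1982_mumfordTateInvariants.{u}) (H : HodgeStructure V n) (hH : H.IsPolarizable)
    {a b : ℕ} (W : Submodule K (hodgeTensorSpaceOver K (K ⊗[ℚ] V) a b))
    (hW : ∀ γ ∈ H.mumfordTateGroupBaseChange K,
      W ≤ W.comap (tensorSpaceActOver (a := a) (b := b) γ).toLinearMap) :
    ∃ W' : Submodule K (hodgeTensorSpaceOver K (K ⊗[ℚ] V) a b),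
      (∀ γ ∈ H.mumfordTateGroupBaseChange K,
        W' ≤ W'.comap (tensorSpaceActOver (a := a) (b := b) γ).toLinearMap) ∧ IsCompl W W' := by
  let Φ := (isBaseChange_tensorSpaceToBaseChange K V a b).equiv
  let ρ : (V ≃ₗ[ℚ] V) → Module.End ℚ (hodgeTensorSpace V a b) :=
    fun g => (tensorSpaceAct g).toLinearMap
  let G₀ : Set (Module.End ℚ (hodgeTensorSpace V a b)) :=
    ρ '' (H.mumfordTateGroup : Set (V ≃ₗ[ℚ] V))
  -- complete reducibility of `MT(H)(ℚ)` on `T^{a,b}`: the rational statement (ii)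
  have hG₀ : ∀ W₁ : Submodule ℚ (hodgeTensorSpace V a b), (∀ e ∈ G₀, ∀ w ∈ W₁, e w ∈ W₁) →
      ∃ W₁' : Submodule ℚ (hodgeTensorSpace V a b),
        (∀ e ∈ G₀, ∀ w ∈ W₁', e w ∈ W₁') ∧ IsCompl W₁ W₁' := by
    intro W₁ hW₁
    obtain ⟨W₁', h₁, h₂⟩ := (h H hH).2 a b W₁ (fun g hg w hw => hW₁ _ ⟨g, hg, rfl⟩ w hw)
    refine ⟨W₁', ?_, h₂⟩
    rintro _ ⟨g, hg, rfl⟩ w hw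
    exact h₁ g hg hw
  -- naturality of `Φ`
  have hΦ : ∀ (g : V ≃ₗ[ℚ] V) (z : K ⊗[ℚ] hodgeTensorSpace V a b),
      Φ ((ρ g).baseChange K z) = tensorSpaceActOver (glBaseChange K V g) (Φ z) := by
    intro g z
    induction z using TensorProduct.induction_on with
    | zero => simp
    | tmul c t =>
      rw [LinearMap.baseChange_tmul, IsBaseChange.equiv_tmul, IsBaseChange.equiv_tmul, map_smul]
      simp [ρ, tensorSpaceToBaseChange_tensorSpaceAct]
    | add z w hz hw => rw [map_add, map_add, hz, hw, map_add, map_add]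
  -- transport `W` to `K ⊗ T^{a,b}` and find a complement there
  let W₀ : Submodule K (K ⊗[ℚ] hodgeTensorSpace V a b) := W.comap Φ.toLinearMap
  have hW₀ : ∀ e ∈ G₀, ∀ w ∈ W₀, e.baseChange K w ∈ W₀ := by
    rintro _ ⟨g, hg, rfl⟩ w hw
    change Φ _ ∈ W
    rw [hΦ]
    exact hW _ (mumfordTateGroup_le_comap K H hg) hw
  haveI : FiniteDimensional ℚ (hodgeTensorSpace V a b) :=
    Module.Finite.of_basis (hodgeTensorBasis (Module.finBasis ℚ V) a b)
  obtain ⟨W₀', hst, hc⟩ := exists_isCompl_of_forall_baseChange_apply_mem' K hG₀ W₀ hW₀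
  refine ⟨W₀'.map Φ.toLinearMap, fun γ hγ => ?_, ?_⟩
  · rintro _ ⟨w, hw, rfl⟩
    -- `x = Φ⁻¹ ∘ γ ∘ Φ` commutes with every `f_K`, `f` in the commutant of `MT(H)(ℚ)`
    let x : Module.End K (K ⊗[ℚ] hodgeTensorSpace V a b) :=
      Φ.symm.toLinearMap ∘ₗ (tensorSpaceActOver (a := a) (b := b) γ).toLinearMap ∘ₗ Φ.toLinearMap
    have hx : ∀ f : Module.End ℚ (hodgeTensorSpace V a b), (∀ e ∈ G₀, f * e = e * f) →
        x * f.baseChange K = f.baseChange K * x := by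
      intro f hf
      let fK : Module.End K (hodgeTensorSpaceOver K (K ⊗[ℚ] V) a b) :=
        Φ.toLinearMap ∘ₗ f.baseChange K ∘ₗ Φ.symm.toLinearMap
      have hfK : ∀ t, fK (tensorSpaceToBaseChange K V a b t) = tensorSpaceToBaseChange K V a b (f t) := by
        intro t
        simp only [fK, Φ, LinearMap.comp_apply, LinearEquiv.coe_coe]
        rw [IsBaseChange.equiv_symm_apply, LinearMap.baseChange_tmul, IsBaseChange.equiv_tmul, one_smul]
      have hcomm := comp_tensorSpaceActOver_eq_of_rational K h H hH f
        (fun g hg => hf _ ⟨g, hg, rfl⟩) fK hfK hγ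
      refine LinearMap.ext fun z => ?_
      have hz := LinearMap.congr_fun hcomm (Φ z)
      simp only [fK, LinearMap.comp_apply, LinearEquiv.coe_coe, LinearEquiv.symm_apply_apply] at hz
      simp only [x, Module.End.mul_apply, LinearMap.comp_apply, LinearEquiv.coe_coe]
      rw [← hz, LinearEquiv.symm_apply_apply]
    refine ⟨x w, hst x hx w hw, ?_⟩
    simp [x]
  · have hWW : W = W₀.map Φ.toLinearMap :=
      (Submodule.map_comap_eq_of_surjective Φ.surjective W).symm
    rw [hWW]
    exact (Submodule.orderIsoMapComap Φ).isCompl_iff.1 hc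

omit [HodgeTensorFacts.{u, u}] in
/-- **`Deligne1982_mumfordTateInvariants_baseChange` follows from `Deligne1982_mumfordTateInvariants`.**
For every field `K ⊇ ℚ` and polarizable `H`: (i) the `MT(H)(K)`-invariants of weight `0` in
`T^{a,b}_K (K ⊗ V)` are spanned by the base-changed rational Hodge classes of type `(0,0)`
(`mem_span_of_forall_mumfordTateGroupBaseChange_of_rational`); (ii) `MT(H)(K)` is completely
reducible on every `T^{a,b}_K (K ⊗ V)`
(`exists_isCompl_of_forall_mumfordTateGroupBaseChange_of_rational`). (Deligne, LNM 900, I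
Prop. 3.4 with its proof and Prop. 3.6, descended to `K`-points.)
[cite: Deligne1982HodgeCycles, I Prop. 3.4 (with proof) and Prop. 3.6] -/
theorem Deligne1982_mumfordTateInvariants_baseChange_of_rational
    (h : Deligne1982_mumfordTateInvariants.{u}) : Deligne1982_mumfordTateInvariants_baseChange.{u} := by
  intro K _ _ V _ _ _ _ n H hH
  exact ⟨fun a b hab s hs =>
      mem_span_of_forall_mumfordTateGroupBaseChange_of_rational K h H hH hab s hs,
    fun a b W hW => exists_isCompl_of_forall_mumfordTateGroupBaseChange_of_rational K h H hH W hW⟩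

end HodgeStructure

end Literature.AlgebraicGeometry.Motives

end
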